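import Mathlib
import Summits.AnomalousDissipation.AnomalousDissipation.Theses.DyadicWallCascade
import Summits.AnomalousDissipation.AnomalousDissipation.Theorems.DyadicRealisation.Negative.WallProfileExistsFalseOfSteadyNSRealAnalytic
import Summits.AnomalousDissipation.AnomalousDissipation.Theorems.DyadicWallCascadeHalfSpaceHierarchyCurlOfDegreeZeroField

/-!
# No real-analytic half-space hierarchy
# (negative lemma for the crux `DyadicWallCascade.HalfSpaceHierarchy`, stmt-AnomalousDissipation-18627)

Refuter file, Negative lane (D-0016), route `DyadicWallCascade` of `Summits/AnomalousDissipation`;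
cdisprove seat `refuter-cdisprove-stmt-AnomalousDissipation-18627-0`.

`not_analyticHalfSpaceHierarchy` refutes the census strengthening S⁺₂
(`StrategyCensus.AnalyticHierarchy` of `Cruxes/HalfSpaceHierarchy/CensusSignatures.lean`) in the
slightly stronger form where only the VELOCITY is assumed real-analytic on the open half-space:
"crux body (verbatim) ∧ `AnalyticOnNhd ℝ V {z > 0}`" is false.

Mechanism (the "trace tower" of the one-shot refuter, made a theorem):
1. `periodic_on_halfSpace_of_analytic` — identity principle on the convex half-space: the unit
   horizontal periods of the band `1 ≤ z ≤ 2` hold everywhere on `{z > 0}`;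
2. `dyadic_periods` — with `V (2X) = V X` this gives every period `2^{-k} eᵢ`, `i = 0, 1`;
3. `const_on_hline` — difference quotients along `2^{-k} eᵢ → 0` kill `∂ᵢV`
   (`DyadicWallCascadeNegative.fderiv_apply_eq_zero_of_dyadic_periods`, imported from the landed
   negative lemma of the same route), so `V` is constant on horizontal lines;
4. the trace on `z = 1` is a constant `c`; zero mass flux gives `c₂ = 0`, so the energy flux is
   `0 ≠ F` — contradiction.

Reading for constructions: a witness is `C^∞` and NOWHERE continued analytically across the whole
half-space — flat (Gavrilov-type) gluing across the dyadic planes `z = 2^j` is forced, and no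
analytic-elliptic reformulation on all of `{z > 0}` can have the witness as a solution.  Neither
the Euler equation nor the pressure nor boundedness is used.
-/

open scoped BigOperators Topology InnerProductSpace
open Filter Set MeasureTheory

-- `Summit.<Summit>.<Problem>` is the tree's mandated summit-side namespace (CONVENTIONS §2); for this
-- single-conjunct summit the two coincide, so the duplicate is deliberate.
set_option linter.dupNamespace false

namespace Summit.AnomalousDissipation.AnomalousDissipation.Theorems

namespace HalfSpaceHierarchyNegative

/-- The open upper half-space `{X₂ > 0}` of `ℝ³` is convex. [folklore] -/
theorem convex_halfSpace : Convex ℝ {X : EuclideanSpace ℝ (Fin 3) | 0 < X 2} :=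
  convex_halfSpace_gt (EuclideanSpace.proj (2 : Fin 3) :
    EuclideanSpace ℝ (Fin 3) →L[ℝ] ℝ).toLinearMap.isLinear (0:ℝ)

/-- Identity principle on the half-space: a field real-analytic on `{X₂ > 0}` that is `v`-periodic on
the open band `1 < X₂ < 2` (`v` horizontal) is `v`-periodic on the whole half-space. [folklore] -/
theorem periodic_on_halfSpace_of_analytic {V : EuclideanSpace ℝ (Fin 3) → EuclideanSpace ℝ (Fin 3)}
    (hV : AnalyticOnNhd ℝ V {X : EuclideanSpace ℝ (Fin 3) | 0 < X 2})
    {v : EuclideanSpace ℝ (Fin 3)} (hv2 : v 2 = 0)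
    (hper : ∀ X : EuclideanSpace ℝ (Fin 3), 1 ≤ X 2 → X 2 ≤ 2 → V (X + v) = V X) :
    ∀ X : EuclideanSpace ℝ (Fin 3), 0 < X 2 → V (X + v) = V X := by
  set H : Set (EuclideanSpace ℝ (Fin 3)) := {X | 0 < X 2} with hH
  have hshift : ∀ X : EuclideanSpace ℝ (Fin 3), (X + v) 2 = X 2 := by intro X; simp [hv2]
  -- the difference is analytic on `H`
  have hg : AnalyticOnNhd ℝ (fun X => V (X + v) - V X) H := by
    intro X hX
    have hin : AnalyticAt ℝ (fun Y : EuclideanSpace ℝ (Fin 3) => Y + v) X :=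
      analyticAt_id.add analyticAt_const
    have h1 : AnalyticAt ℝ (fun Y => V (Y + v)) X :=
      (hV (X + v) (by simp only [hH, Set.mem_setOf_eq, hshift]; exact hX)).comp (f := fun Y => Y + v) hin
    exact h1.sub (hV X hX)
  -- it vanishes near the band point `z₀ = (0, 0, 3/2)`
  set z₀ : EuclideanSpace ℝ (Fin 3) := !₂[(0:ℝ), (0:ℝ), (3/2:ℝ)] with hz₀
  have hz₀2 : z₀ 2 = 3/2 := by simp [hz₀]
  have hz₀H : z₀ ∈ H := by simp only [hH, Set.mem_setOf_eq, hz₀2]; norm_num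
  have hopen : IsOpen {X : EuclideanSpace ℝ (Fin 3) | 1 < X 2 ∧ X 2 < 2} := by
    have hc : Continuous fun X : EuclideanSpace ℝ (Fin 3) => X 2 :=
      PiLp.continuous_apply 2 (fun _ : Fin 3 => ℝ) (2 : Fin 3)
    exact (isOpen_lt continuous_const hc).inter (isOpen_lt hc continuous_const)
  have hev : (fun X => V (X + v) - V X) =ᶠ[𝓝 z₀] 0 := by
    filter_upwards [hopen.mem_nhds (show z₀ ∈ {X : EuclideanSpace ℝ (Fin 3) | 1 < X 2 ∧ X 2 < 2} by
      simp only [Set.mem_setOf_eq, hz₀2]; norm_num)] with X hX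
    simp only [Pi.zero_apply, sub_eq_zero]
    exact hper X hX.1.le hX.2.le
  have hEq := hg.eqOn_zero_of_preconnected_of_eventuallyEq_zero convex_halfSpace.isPreconnected hz₀H hev
  intro X hX
  have := hEq (show X ∈ H from hX)
  simpa [sub_eq_zero] using this

/-- Iterated dilation invariance: `V (2^k • X) = V X` on the half-space. [folklore] -/
theorem dilate_pow {V : EuclideanSpace ℝ (Fin 3) → EuclideanSpace ℝ (Fin 3)}
    (hdil : ∀ X : EuclideanSpace ℝ (Fin 3), 0 < X 2 → V ((2 : ℝ) • X) = V X) :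
    ∀ (k : ℕ) (X : EuclideanSpace ℝ (Fin 3)), 0 < X 2 → V ((2 : ℝ) ^ k • X) = V X := by
  intro k
  induction k with
  | zero => intro X _; simp
  | succ k ih =>
    intro X hX
    have hkX : 0 < ((2 : ℝ) ^ k • X) 2 := by
      simp only [PiLp.smul_apply, smul_eq_mul]; positivity
    rw [pow_succ, mul_comm, mul_smul, hdil _ hkX, ih X hX]

/-- Dilation invariance plus a horizontal period `v` on the half-space give every dyadic period
`(2^k)⁻¹ • v`. [folklore] -/
theorem dyadic_periods {V : EuclideanSpace ℝ (Fin 3) → EuclideanSpace ℝ (Fin 3)}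
    (hdil : ∀ X : EuclideanSpace ℝ (Fin 3), 0 < X 2 → V ((2 : ℝ) • X) = V X)
    {v : EuclideanSpace ℝ (Fin 3)} (hv2 : v 2 = 0)
    (hper : ∀ X : EuclideanSpace ℝ (Fin 3), 0 < X 2 → V (X + v) = V X)
    (k : ℕ) (X : EuclideanSpace ℝ (Fin 3)) (hX : 0 < X 2) :
    V (X + ((2 : ℝ) ^ k)⁻¹ • v) = V X := by
  have hX' : 0 < (X + ((2 : ℝ) ^ k)⁻¹ • v) 2 := by simp [hv2, hX]
  have hkX : 0 < ((2 : ℝ) ^ k • X) 2 := by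
    simp only [PiLp.smul_apply, smul_eq_mul]; positivity
  rw [← dilate_pow hdil k _ hX', smul_add, smul_smul, mul_inv_cancel₀ (pow_ne_zero k two_ne_zero),
    one_smul, hper _ hkX, dilate_pow hdil k X hX]

/-- A field differentiable on the half-space with all dyadic periods `(2^k)⁻¹ • v` (`v` horizontal)
is constant on the horizontal lines `t ↦ B + t • v`. [folklore] -/
theorem const_on_hline {V : EuclideanSpace ℝ (Fin 3) → EuclideanSpace ℝ (Fin 3)}
    {v : EuclideanSpace ℝ (Fin 3)} (hv2 : v 2 = 0)
    (hVd : ∀ X : EuclideanSpace ℝ (Fin 3), 0 < X 2 → DifferentiableAt ℝ V X)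
    (hper : ∀ (k : ℕ) (X : EuclideanSpace ℝ (Fin 3)), 0 < X 2 → V (X + ((2 : ℝ) ^ k)⁻¹ • v) = V X)
    (B : EuclideanSpace ℝ (Fin 3)) (hB : 0 < B 2) (t : ℝ) : V (B + t • v) = V B := by
  have hc : ∀ c : ℝ, (B + c • v) 2 = B 2 := by intro c; simp [hv2]
  have hpos : ∀ c : ℝ, 0 < (B + c • v) 2 := fun c => by rw [hc]; exact hB
  have hD : ∀ s : ℝ, HasDerivAt (fun r : ℝ => V (B + r • v)) (fderiv ℝ V (B + s • v) v) s := by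
    intro s
    have hℓ : HasDerivAt (fun r : ℝ => B + r • v) v s := by
      simpa using ((hasDerivAt_id s).smul_const v).const_add B
    exact (hVd _ (hpos s)).hasFDerivAt.comp_hasDerivAt s hℓ
  have h0 : ∀ s : ℝ, fderiv ℝ V (B + s • v) v = 0 := fun s =>
    DyadicWallCascadeNegative.fderiv_apply_eq_zero_of_dyadic_periods (hVd _ (hpos s))
      fun k => hper k _ (hpos s)
  have hdiff : Differentiable ℝ (fun r : ℝ => V (B + r • v)) := fun s => (hD s).differentiableAt
  have hder : ∀ s, deriv (fun r : ℝ => V (B + r • v)) s = 0 := fun s => by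
    rw [(hD s).deriv, h0 s]
  have := is_const_of_deriv_eq_zero hdiff hder t 0
  simpa using this

end HalfSpaceHierarchyNegative

open HalfSpaceHierarchyNegative in
/-- **No real-analytic half-space hierarchy** (refutes — in slightly stronger form, analyticity of
`V` alone — the census strengthening S⁺₂ `AnalyticHierarchy` of the crux
`DyadicWallCascade.HalfSpaceHierarchy`, stmt-AnomalousDissipation-18627: crux body verbatim ∧
`AnalyticOnNhd ℝ V {z > 0}`).  Identity principle: the unit horizontal periods of the band
`1 ≤ z ≤ 2` propagate to the whole half-space (`periodic_on_halfSpace_of_analytic`); dilation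
invariance then gives every period `2^{-k} eᵢ` (`dyadic_periods`); difference quotients give
`∂₀V = ∂₁V = 0`, so `V` is constant on horizontal lines (`const_on_hline`); the trace on `z = 1`
is a constant `c` with `c₂ = 0` by the zero-mass-flux clause, and the energy flux vanishes,
against `F ≠ 0`.  Reading for constructions: every witness of the crux is `C^∞` but NOT
real-analytic on the half-space — it must be glued flat across the dyadic planes (Gavrilov-type
`C^∞`-flat edges or flat head plateaus); in particular it is not a solution of any analytic
elliptic reformulation on the whole half-space.  The Euler equation and the pressure are not used.
[folklore] -/
theorem not_analyticHalfSpaceHierarchy :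
    ¬ (∃ (V : EuclideanSpace ℝ (Fin 3) → EuclideanSpace ℝ (Fin 3)) (Q : EuclideanSpace ℝ (Fin 3) → ℝ) (C F : ℝ),
        (let H : Set (EuclideanSpace ℝ (Fin 3)) := {X | 0 < X 2}
         let e : Fin 3 → EuclideanSpace ℝ (Fin 3) := fun i => EuclideanSpace.single i (1 : ℝ)
         let pt : ℝ × ℝ → EuclideanSpace ℝ (Fin 3) := fun q => !₂[q.1, q.2, (1 : ℝ)]
         ContDiffOn ℝ ((⊤ : ℕ∞) : WithTop ℕ∞) V H ∧ ContDiffOn ℝ ((⊤ : ℕ∞) : WithTop ℕ∞) Q H ∧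
         (∀ X ∈ H, ‖V X‖ ≤ C ∧ |Q X| ≤ C) ∧ (∀ X ∈ H, ∑ i : Fin 3, (fderiv ℝ V X (e i)) i = 0) ∧
         (∀ X ∈ H, (fderiv ℝ V X) (V X) + gradient Q X = 0) ∧
         (∀ X ∈ H, V ((2 : ℝ) • X) = V X ∧ Q ((2 : ℝ) • X) = Q X) ∧
         (∀ X : EuclideanSpace ℝ (Fin 3), 1 ≤ X 2 → X 2 ≤ 2 →
            V (X + e 0) = V X ∧ V (X + e 1) = V X ∧ Q (X + e 0) = Q X ∧ Q (X + e 1) = Q X) ∧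
         (∫ q in Set.Icc (0 : ℝ) 1 ×ˢ Set.Icc (0 : ℝ) 1, (V (pt q)) 2 = 0) ∧ F ≠ 0 ∧
         (∫ q in Set.Icc (0 : ℝ) 1 ×ˢ Set.Icc (0 : ℝ) 1, (V (pt q)) 2 * (‖V (pt q)‖ ^ 2 / 2 + Q (pt q)) = F)) ∧
        AnalyticOnNhd ℝ V {X : EuclideanSpace ℝ (Fin 3) | 0 < X 2}) := by
  rintro ⟨V, Q, C, F, hbody, hVan⟩
  simp only at hbody
  obtain ⟨hVs, _hQs, _hbdd, _hdiv, _hEul, hdil, hper, hmass, hF, hflux⟩ := hbody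
  have hVd : ∀ X : EuclideanSpace ℝ (Fin 3), 0 < X 2 → DifferentiableAt ℝ V X := fun X hX =>
    (hVs.differentiableOn (by simp) X hX).differentiableAt
      (HalfSpaceHierarchy.isOpen_halfSpace_coord_two_pos.mem_nhds hX)
  have hdilV : ∀ X : EuclideanSpace ℝ (Fin 3), 0 < X 2 → V ((2 : ℝ) • X) = V X :=
    fun X hX => (hdil X hX).1
  have he0 : (EuclideanSpace.single (0 : Fin 3) (1 : ℝ)) 2 = 0 := by simp
  have he1 : (EuclideanSpace.single (1 : Fin 3) (1 : ℝ)) 2 = 0 := by simp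
  -- unit periods on the whole half-space (identity principle), then all dyadic periods
  have hP0 := periodic_on_halfSpace_of_analytic hVan he0 (fun X h1 h2 => (hper X h1 h2).1)
  have hP1 := periodic_on_halfSpace_of_analytic hVan he1 (fun X h1 h2 => (hper X h1 h2).2.1)
  have hD0 := dyadic_periods hdilV he0 hP0
  have hD1 := dyadic_periods hdilV he1 hP1
  -- the trace of `V` on the plane `X₂ = 1` is constant
  have hpt2 : ∀ a b : ℝ, (!₂[a, b, (1 : ℝ)] : EuclideanSpace ℝ (Fin 3)) 2 = 1 := by intro a b; simp
  have hline0 : ∀ a b : ℝ, (!₂[a, b, (1 : ℝ)] : EuclideanSpace ℝ (Fin 3))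
      = !₂[(0 : ℝ), b, (1 : ℝ)] + a • EuclideanSpace.single (0 : Fin 3) (1 : ℝ) := by
    intro a b; ext i; fin_cases i <;> simp
  have hline1 : ∀ b : ℝ, (!₂[(0 : ℝ), b, (1 : ℝ)] : EuclideanSpace ℝ (Fin 3))
      = !₂[(0 : ℝ), (0 : ℝ), (1 : ℝ)] + b • EuclideanSpace.single (1 : Fin 3) (1 : ℝ) := by
    intro b; ext i; fin_cases i <;> simp
  have hconst : ∀ q : ℝ × ℝ, V !₂[q.1, q.2, (1 : ℝ)] = V !₂[(0 : ℝ), (0 : ℝ), (1 : ℝ)] := by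
    intro q
    rw [hline0 q.1 q.2, const_on_hline he0 hVd hD0 _ (by rw [hpt2]; norm_num), hline1 q.2,
      const_on_hline he1 hVd hD1 _ (by rw [hpt2]; norm_num)]
  -- zero mass flux forces the vertical trace to vanish, hence zero energy flux
  simp_rw [hconst] at hmass hflux
  have hvol : (volume : Measure (ℝ × ℝ)).real (Set.Icc (0 : ℝ) 1 ×ˢ Set.Icc (0 : ℝ) 1) = 1 := by
    simp only [Measure.real]
    rw [Measure.volume_eq_prod, Measure.prod_prod, Real.volume_Icc]
    simp
  rw [setIntegral_const, hvol, one_smul] at hmass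
  rw [hmass] at hflux
  simp at hflux
  exact hF hflux.symm

end Summit.AnomalousDissipation.AnomalousDissipation.Theorems
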